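import Summits.BirchSwinnertonDyer.Rank1Residual.AdditivePotMult.QuadraticBaseChangeOddTamagawaAdditiveWithTwo
import Summits.BirchSwinnertonDyer.Rank1Residual.AdditivePotMult.QuadraticBaseChangeDescentReal
import Summits.BirchSwinnertonDyer.Rank1Residual.AdditivePotMult.ClassTheoremsNoMilne
import HarnessLib

/-!
# The base-change-and-descend END and the X4(M)⁰ / X3♯(M)⁰ class twins at EVERY odd `p`
# (`p = 3` included), additive places prime to `d_K` of EVERY Kodaira type allowed, CONDITIONAL on A233
# (row T-MIL-3, FILE H-5b — FILES H-2 / H-3 with the `ℓ = 2` clause discharged by row T-MIL-B2;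
# seat n1011-p01 GEN 8)

HONEST FRAMING (cell `b2b-bsdres`, run/shared/lean/b2b/bsd-rank1-residual/, verbatim in every
file): the goal of the cell is to DELETE the COMBINATION-SHAPED residual classes of the
Birch–Swinnerton-Dyer formula for ALL analytic-rank `≤ 1` elliptic curves over `ℚ` — "full BSD
formula for every rank `≤ 1` curve in class `C`" assembled STRICTLY from published theorems — so
that the rank-`≤ 1` remainder becomes exactly the CONSTRUCTION-SHAPED classes, which are TYPED
(missing-input `Prop`s), NOT attempted. This is not "finishing BSD". Sub-classes X3♯(M) / X4(M)
(additive, potentially multiplicative prime; base-change-and-descend): a RESEARCH ROUTE; they stay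
CONSTRUCTION-SHAPED; nothing is booked by this file; no mark / label moved. THEOREMS ONLY: no
definition, no named fact, no `sorry`.

## What

FILES H-2 / H-3 (`QuadraticBaseChangeDescentUnramifiedFactOddPrime`, `ClassTheoremsNoMilneUnramifiedFact`)
descend at every odd `p` under the proviso
`p = 3 → ℓ_v ≠ 3 ∧ (ℓ_v = 2 → d_K % 8 = 1 ∨ (W.kodairaSymbolAt v ≠ IV ∧ W.kodairaSymbolAt v ≠ IV*))`.
FILE H-5a (`padicValRat_norm_mul_tamagawaProduct_eq_of_unramifiedFact_oddPrime`) removed the `ℓ = 2`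
clause by row T-MIL-B2's fact-free `𝔽₂` flip (n1011-p16). This file repeats H-2 / H-3 over H-5a —
the additive disjunct of `hS` now carries ONLY `p = 3 → ℓ_v ≠ 3`:

* `milneQuotient_ordp_of_unramifiedFact_imaginary_oddPrime` / `…_real_oddPrime` (`hWR_p`, total rank
  `≤ 1`, GIVEN `hA`);
* **`bsdp_of_pPartOver_of_bsdp_twist_quadratic_of_unramifiedFact_oddPrime`** — `BSDp W p ⟸
  MissingPPartOverAt W' p ∧ BSDp Wd p`, either signature, `d_K` odd squarefree, total analytic rank
  `≤ 1`, every odd `p` (`hGZK`, `hmod`, `hA`);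
* **`…_oddPrime_of_dvd_discr` — the IN-CLASS form (`p ∣ d_K`, e.g. `K = ℚ(√p*)`, `ℚ(√−3)` at
  `p = 3`): `hS` is EXACTLY FILE G-1's S₃ hypothesis** (`W` good ∨ multiplicative ∨ (`ℓ ∣ d_K` ∧ `Wd`
  multiplicative) ∨ (additive ∧ `ℓ ∤ d_K`)) — G-1's END with `5 ≤ p` replaced by `p ≠ 2 ∧ p ∣ d_K`;
* `bsdp_of_classX4M_of_rankZero_twist_noMilne_of_unramifiedFact_oddPrime`,
  `bsdp_of_classX3M_of_rankZero_twist_noMilne_of_unramifiedFact_oddPrime` — E-4's class theorems on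
  that population (Skinner 2016 Thm. C `hSk` / Wuthrich 2014 Prop. 21 `hW`, `hGZK`, `hmod`, `hA`).

HONEST LIMITS: CONDITIONAL on A233 (`hA`, W only; row T-A233 of n1011-p16 discharges it); NOT
covered at `p = 3`: additive `W` at an UNRAMIFIED `3` (never in-class); `d_K` odd squarefree; total
analytic rank `≤ 1`; twist of analytic rank `0` in the class twins; even `d_K`, `p = 2`, total rank
`≥ 2` not treated; X3♯(M)/X4(M) stay CONSTRUCTION-SHAPED — `MissingPPartOverAt` (and the X2 lower
bound) untouched; TOOL/END theorems; closes no class; moves no mark; H-2 / H-3 / G-1 / E-4 untouched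
(dominated twins).

References: J. S. Milne, Invent. Math. 17 (1972) [Milne1972ArithmeticAV]; C. Skinner, Pacific J.
Math. 283 (2016) Thm. C [Skinner2016PacificMC]; C. Wuthrich, Doc. Math. 19 (2014) Prop. 21
[Wuthrich2014]; J. H. Silverman, *AEC* Prop. VII.5.4 (a) [SilvermanAEC2009], *ATAEC* IV.9.4,
Table 4.1 [SilvermanATAEC1994]; T. and V. Dokchitser, Ann. of Math. 172 (2010) §2.1
[DokchitserDokchitserAnnals2010]; R. L. Miller, LMS J. Comput. Math. 14 (2011) Def. 1.1 [Miller2011LMS].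
-/

noncomputable section

open scoped Classical NumberField

open WeierstrassCurve NumberField NumberField.InfinitePlace IsDedekindDomain Rat.HeightOneSpectrum
  Literature.NumberTheory.EllipticCurves Literature.NumberTheory.EllipticCurves.Rank1Residual
  Literature.NumberTheory.EllipticCurves.Rank1Residual.Typed
  Literature.NumberTheory.EllipticCurves.Wuthrich2014
  Literature.NumberTheory.DiophantineGeometry

namespace Summit.BirchSwinnertonDyer.Rank1Residual.AdditivePotMult


section UnramifiedFactOddPrime

variable (W : WeierstrassCurve ℚ) [W.IsElliptic] [W.IsGloballyMinimal] (p : ℕ) [hp : Fact p.Prime]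
  (K : Type) [Field K] [NumberField K]
  (Wd : WeierstrassCurve ℚ) [Wd.IsElliptic] [Wd.IsGloballyMinimal]
  (W' : WeierstrassCurve K) [W'.IsElliptic] [W'.IsGloballyMinimal]

/-- **`hWR_p` at every odd `p`, IMAGINARY `K`, total rank `≤ 1`, CONDITIONAL on A233 (`hA`)**:
FILE E-2's schema with `n = n_W` (tree `realPeriod_mul_realPeriod_quadraticTwist_eq_mul_bsdPeriod`),
`m ∈ {1,2,4}` (FILE E-1) and FILE H-5a's END `padicValRat_norm_mul_tamagawaProduct_eq_of_unramifiedFact_oddPrime`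
(additive disjunct with ONLY `p = 3 → ℓ_v ≠ 3`). H-2's `…_imaginary_odd` without the `ℓ = 2` clause.
[cite: Milne1972ArithmeticAV, §1 Thm. 1 and §2 (through DokchitserDokchitserAnnals2010, §2.1, proof of Thm. 8)]
[cite: SilvermanAEC2009, Prop. VII.5.4 (a)] [cite: SilvermanATAEC1994, IV.9.4 and Table 4.1] -/
theorem milneQuotient_ordp_of_unramifiedFact_imaginary_oddPrime [IsTotallyComplex K]
    (h2 : Module.finrank ℚ K = 2)
    (hdodd : Odd (NumberField.discr K)) (hdsq : Squarefree (NumberField.discr K))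
    {Cd : VariableChange ℚ} (hWd : Cd • W.quadraticTwist (NumberField.discr K : ℚ) = Wd)
    {C' : VariableChange K} (hW' : C' • W.baseChange K = W') [Finite W.sha] [Finite Wd.sha]
    (hr : W.mordellWeilRank + Wd.mordellWeilRank ≤ 1)
    (hA : ∀ (v : HeightOneSpectrum (𝓞 ℚ)) (w : HeightOneSpectrum (𝓞 K)),
      kodairaSymbolAt_baseChange_of_ramificationIdx_eq_one K v w W)
    (hp2 : p ≠ 2)
    (hS : ∀ v : HeightOneSpectrum (𝓞 ℚ), W.HasGoodReductionAt v ∨ W.HasMultiplicativeReductionAt v ∨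
      (((primesEquiv v : ℕ) : ℤ) ∣ NumberField.discr K ∧ Wd.HasMultiplicativeReductionAt v) ∨
      (W.HasAdditiveReductionAt v ∧ ¬ ((primesEquiv v : ℕ) : ℤ) ∣ NumberField.discr K ∧
        (p = 3 → (primesEquiv v : ℕ) ≠ 3))) :
    ∃ q : ℚ, 0 < q ∧ padicValRat p q = 0 ∧
      (W'.shaOrder : ℝ) * W'.regulator * W'.bsdPeriod * (W'.tamagawaProduct : ℝ) /
          (W'.torsionOrder : ℝ) ^ 2 = (q : ℝ) * (W.bsdRHS * Wd.bsdRHS) := by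
  obtain ⟨m, hm124, hm⟩ := exists_mul_regulator_baseChange_quadratic_of_rank_add_le_one W K h2 Wd
    ⟨Cd, hWd⟩ W' ⟨C', hW'⟩ hr
  have hm0 : m ≠ 0 := by rcases hm124 with rfl | rfl | rfl <;> norm_num
  have hn0 : (W.baseChange ℝ).numRealComponents ≠ 0 := (W.baseChange ℝ).numRealComponents_pos.ne'
  haveI : Fact (Nat.Prime 2) := ⟨Nat.prime_two⟩
  have h2v : padicValRat p (2 : ℚ) = 0 := by
    rw [show (2 : ℚ) = ((2 : ℕ) : ℚ) by norm_num, padicValRat.of_nat, padicValNat_primes hp2,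
      Nat.cast_zero]
  have hnv : padicValRat p ((W.baseChange ℝ).numRealComponents : ℚ) = 0 := by
    rw [numRealComponents_baseChange_real]
    split_ifs
    · rw [padicValRat.of_nat, padicValNat_primes hp2, Nat.cast_zero]
    · rw [Nat.cast_one, padicValRat.one]
  have hmv : padicValRat p (m : ℚ) = 0 := by
    rcases hm124 with rfl | rfl | rfl
    · rw [Nat.cast_one, padicValRat.one]
    · exact_mod_cast h2v
    · rw [show ((4 : ℕ) : ℚ) = (2 : ℚ) ^ 2 by norm_num, padicValRat.pow, h2v, mul_zero]
  exact milneQuotient_ordp_of_tamagawa_of_arch_of_regulator W K Wd W' h2 hWd hW' hn0 hm0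
    (realPeriod_mul_realPeriod_quadraticTwist_eq_mul_bsdPeriod W K h2) hm p hp2 hnv hmv
    (padicValRat_norm_mul_tamagawaProduct_eq_of_unramifiedFact_oddPrime W K Wd W' h2 hdodd hdsq hWd hW' hA
      p hp2 hS)

/-- **`hWR_p` at every odd `p`, REAL `K` (`hreal`), total rank `≤ 1`, CONDITIONAL on A233 (`hA`)**:
as above with `n = 1` (FILE F-1). H-2's `…_real_odd` without the `ℓ = 2` clause.
[cite: Milne1972ArithmeticAV, §1 Thm. 1 and §2 (through DokchitserDokchitserAnnals2010, §2.1, proof of Thm. 8)]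
[cite: SilvermanAEC2009, Prop. VII.5.4 (a)] [cite: SilvermanATAEC1994, IV.9.4 and Table 4.1] -/
theorem milneQuotient_ordp_of_unramifiedFact_real_oddPrime (h2 : Module.finrank ℚ K = 2)
    (hreal : IsTotallyReal K)
    (hdodd : Odd (NumberField.discr K)) (hdsq : Squarefree (NumberField.discr K))
    {Cd : VariableChange ℚ} (hWd : Cd • W.quadraticTwist (NumberField.discr K : ℚ) = Wd)
    {C' : VariableChange K} (hW' : C' • W.baseChange K = W') [Finite W.sha] [Finite Wd.sha]
    (hr : W.mordellWeilRank + Wd.mordellWeilRank ≤ 1)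
    (hA : ∀ (v : HeightOneSpectrum (𝓞 ℚ)) (w : HeightOneSpectrum (𝓞 K)),
      kodairaSymbolAt_baseChange_of_ramificationIdx_eq_one K v w W)
    (hp2 : p ≠ 2)
    (hS : ∀ v : HeightOneSpectrum (𝓞 ℚ), W.HasGoodReductionAt v ∨ W.HasMultiplicativeReductionAt v ∨
      (((primesEquiv v : ℕ) : ℤ) ∣ NumberField.discr K ∧ Wd.HasMultiplicativeReductionAt v) ∨
      (W.HasAdditiveReductionAt v ∧ ¬ ((primesEquiv v : ℕ) : ℤ) ∣ NumberField.discr K ∧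
        (p = 3 → (primesEquiv v : ℕ) ≠ 3))) :
    ∃ q : ℚ, 0 < q ∧ padicValRat p q = 0 ∧
      (W'.shaOrder : ℝ) * W'.regulator * W'.bsdPeriod * (W'.tamagawaProduct : ℝ) /
          (W'.torsionOrder : ℝ) ^ 2 = (q : ℝ) * (W.bsdRHS * Wd.bsdRHS) :=
  milneQuotient_ordp_of_tamagawa_real W p K Wd W' h2 hreal hWd hW' hr hp2
    (padicValRat_norm_mul_tamagawaProduct_eq_of_unramifiedFact_oddPrime W K Wd W' h2 hdodd hdsq hWd hW' hA
      p hp2 hS)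

/-- **THE BASE-CHANGE-AND-DESCEND END AT EVERY ODD `p` (`p = 3` INCLUDED), EITHER SIGNATURE,
CONDITIONAL ON A233 (not on A65).** `W/ℚ`, `Wd = C_d • W^{(d_K)}`, `W' = C' • W_K` globally
minimal; `[K:ℚ] = 2` with `d_K` odd squarefree; `r_an(W) + r_an(Wd) ≤ 1`; `p` odd; at every place
`W` is good ∨ multiplicative ∨ (`ℓ ∣ d_K` ∧ `Wd` multiplicative) ∨ (ADDITIVE with `ℓ ∤ d_K` and
the clause `p = 3 → ℓ ≠ 3`); `hA` = the named
fact A233 `kodairaSymbolAt_baseChange_of_ramificationIdx_eq_one` at every `(v, w)`. THEN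
**`BSDp W p ⟸ MissingPPartOverAt W' p ∧ BSDp Wd p`** (other hypotheses: `hGZK`, `hmod`). H-2's END
without the `ℓ = 2` clause (row T-MIL-B2's `𝔽₂` flip consumed by H-5a); at `p ≥ 5` the clause is
vacuous (G-1). So at `p = 3` too the descent on S₂/S₃ trades Milne's A65 for A233, every Kodaira
type at `2` included. NOT CLAIMED: at `p = 3`, additive `W` at an unramified `3` (never in-class); even `d_K`; `p = 2`;
total analytic rank `≥ 2`; A233 itself (hypothesis `hA`, W only).
[cite: Milne1972ArithmeticAV, §1 Thm. 1 and §2 (through DokchitserDokchitserAnnals2010, §2.1, proof of Thm. 8)]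
[cite: SilvermanAEC2009, Prop. VII.5.4 (a)] [cite: SilvermanATAEC1994, IV.9.4 and Table 4.1]
[cite: Miller2011LMS, Def. 1.1 (arXiv:1010.2431 p. 3)] -/
theorem bsdp_of_pPartOver_of_bsdp_twist_quadratic_of_unramifiedFact_oddPrime
    (hGZK : rank_eq_analyticRank_of_analyticRank_le_one) (hmod : hasEntireLFunction_rat)
    (h2 : Module.finrank ℚ K = 2)
    (hdodd : Odd (NumberField.discr K)) (hdsq : Squarefree (NumberField.discr K))
    {Cd : VariableChange ℚ} (hWd : Cd • W.quadraticTwist (NumberField.discr K : ℚ) = Wd)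
    {C' : VariableChange K} (hW' : C' • W.baseChange K = W')
    (hr : W.analyticRank + Wd.analyticRank ≤ 1)
    (hA : ∀ (v : HeightOneSpectrum (𝓞 ℚ)) (w : HeightOneSpectrum (𝓞 K)),
      kodairaSymbolAt_baseChange_of_ramificationIdx_eq_one K v w W)
    (hp2 : p ≠ 2)
    (hS : ∀ v : HeightOneSpectrum (𝓞 ℚ), W.HasGoodReductionAt v ∨ W.HasMultiplicativeReductionAt v ∨
      (((primesEquiv v : ℕ) : ℤ) ∣ NumberField.discr K ∧ Wd.HasMultiplicativeReductionAt v) ∨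
      (W.HasAdditiveReductionAt v ∧ ¬ ((primesEquiv v : ℕ) : ℤ) ∣ NumberField.discr K ∧
        (p = 3 → (primesEquiv v : ℕ) ≠ 3)))
    (hK : MissingPPartOverAt W' p) (hd : BSDp Wd p) : BSDp W p := by
  have hr1 : W.analyticRank ≤ 1 := by omega
  have hrd1 : Wd.analyticRank ≤ 1 := by omega
  obtain ⟨hrankW, hfinW⟩ := hGZK W hr1
  obtain ⟨hrankD, hfinD⟩ := hGZK Wd hrd1
  haveI : Finite W.sha := hfinW
  haveI : Finite Wd.sha := hfinD
  have hrMW : W.mordellWeilRank + Wd.mordellWeilRank ≤ 1 := by rw [hrankW, hrankD]; exact hr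
  rcases isTotallyReal_or_isTotallyComplex_of_finrank_eq_two K h2 with hR | hC
  · exact bsdp_of_pPartOver_of_bsdp_twist_ordp W p K Wd W' hGZK hmod hr1 h2 ⟨Cd, hWd⟩ hrd1 ⟨C', hW'⟩
      (milneQuotient_ordp_of_unramifiedFact_real_oddPrime W p K Wd W' h2 hR hdodd hdsq hWd hW' hrMW hA hp2
        hS) hK hd
  · haveI := hC
    exact bsdp_of_pPartOver_of_bsdp_twist_ordp W p K Wd W' hGZK hmod hr1 h2 ⟨Cd, hWd⟩ hrd1 ⟨C', hW'⟩
      (milneQuotient_ordp_of_unramifiedFact_imaginary_oddPrime W p K Wd W' h2 hdodd hdsq hWd hW' hrMW hA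
        hp2 hS) hK hd

/-- **The in-class form: `K` RAMIFIED at `p` (`p ∣ d_K` — e.g. the canonical `K = ℚ(√p*)` of the
X3♯(M)/X4(M) descent at `p`, `ℚ(√−3)` at `p = 3`).** Then the clause `p = 3 → ℓ ≠ 3` is automatic
(an additive place with `ℓ ∤ d_K` is not over `p`), and the local hypothesis is EXACTLY FILE G-1's S₃
hypothesis: `W` good ∨ multiplicative ∨ (`ℓ ∣ d_K` ∧ `Wd` multiplicative) ∨ (additive ∧ `ℓ ∤ d_K`)
— G-1's END with `5 ≤ p` replaced by `p ≠ 2 ∧ p ∣ d_K`. Same conclusion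
`BSDp W p ⟸ MissingPPartOverAt W' p ∧ BSDp Wd p`, CONDITIONAL on A233 (`hA`).
[cite: Milne1972ArithmeticAV, §1 Thm. 1 and §2 (through DokchitserDokchitserAnnals2010, §2.1, proof of Thm. 8)]
[cite: SilvermanAEC2009, Prop. VII.5.4 (a)] [cite: SilvermanATAEC1994, IV.9.4 and Table 4.1] -/
theorem bsdp_of_pPartOver_of_bsdp_twist_quadratic_of_unramifiedFact_oddPrime_of_dvd_discr
    (hGZK : rank_eq_analyticRank_of_analyticRank_le_one) (hmod : hasEntireLFunction_rat)
    (h2 : Module.finrank ℚ K = 2)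
    (hdodd : Odd (NumberField.discr K)) (hdsq : Squarefree (NumberField.discr K))
    (hpd : (p : ℤ) ∣ NumberField.discr K)
    {Cd : VariableChange ℚ} (hWd : Cd • W.quadraticTwist (NumberField.discr K : ℚ) = Wd)
    {C' : VariableChange K} (hW' : C' • W.baseChange K = W')
    (hr : W.analyticRank + Wd.analyticRank ≤ 1)
    (hA : ∀ (v : HeightOneSpectrum (𝓞 ℚ)) (w : HeightOneSpectrum (𝓞 K)),
      kodairaSymbolAt_baseChange_of_ramificationIdx_eq_one K v w W)
    (hp2 : p ≠ 2)
    (hS : ∀ v : HeightOneSpectrum (𝓞 ℚ), W.HasGoodReductionAt v ∨ W.HasMultiplicativeReductionAt v ∨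
      (((primesEquiv v : ℕ) : ℤ) ∣ NumberField.discr K ∧ Wd.HasMultiplicativeReductionAt v) ∨
      (W.HasAdditiveReductionAt v ∧ ¬ ((primesEquiv v : ℕ) : ℤ) ∣ NumberField.discr K))
    (hK : MissingPPartOverAt W' p) (hd : BSDp Wd p) : BSDp W p := by
  refine bsdp_of_pPartOver_of_bsdp_twist_quadratic_of_unramifiedFact_oddPrime W p K Wd W' hGZK hmod h2
    hdodd hdsq hWd hW' hr hA hp2 (fun v => ?_) hK hd
  rcases hS v with h | h | h | ⟨hadd, hnd⟩
  · exact Or.inl h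
  · exact Or.inr (Or.inl h)
  · exact Or.inr (Or.inr (Or.inl h))
  · refine Or.inr (Or.inr (Or.inr ⟨hadd, hnd, fun hp3 hv3 => hnd ?_⟩))
    rw [hv3, ← hp3]
    exact hpd

end UnramifiedFactOddPrime


section NoMilneUnramifiedFactOddPrime

variable (W : WeierstrassCurve ℚ) [W.IsElliptic] [W.IsGloballyMinimal] (p : ℕ) [Fact p.Prime]
  (K : Type) [Field K] [NumberField K]
  (Wd : WeierstrassCurve ℚ) [Wd.IsElliptic] [Wd.IsGloballyMinimal]
  (W' : WeierstrassCurve K) [W'.IsElliptic] [W'.IsGloballyMinimal]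

/-- **X4(M)⁰ WITHOUT MILNE, additive places prime to `d_K` allowed, every odd `p` (`p = 3`
included), CONDITIONAL on A233.** For `(E,p) ∈ X4(M)` (odd additive `p`, `E[p]` irreducible,
`ord_p j < 0`) of analytic rank `≤ 1`, a quadratic field `K` (either signature) with `d_K` odd
squarefree whose twist `Wd = C_d • W^{(d_K)}` is MULTIPLICATIVE at `p`, of analytic rank `0`, with
(ram), `W` good ∨ multiplicative ∨ (`ℓ ∣ d_K` ∧ `Wd` multiplicative) ∨ (additive ∧ `ℓ ∤ d_K` ∧ the
clause `p = 3 → ℓ ≠ 3`) at every place, a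
globally minimal `K`-model `W' = C' • W_K`, and the named fact A233 at every `(v, w)` as `hA`:
**`BSD(E, p)` follows from the typed over-`K` input `MissingPPartOverAt W' p` ALONE**, the other
inputs being Skinner 2016 Thm. C (`hSk`: the twist is COVERED, `bsdp_twist_of_rankZero_ram`),
`hGZK`, `hmod`, `hA` — NOT Milne's A65. Twin of H-3's `…_of_unramifiedFact`
without the `ℓ = 2` clause (H-5b's END `bsdp_of_pPartOver_of_bsdp_twist_quadratic_of_unramifiedFact_oddPrime`).
Nothing asserts that such `K` exists for a given pair. [cite: Skinner2016PacificMC, Thm. C (§1), footnote 1, §2.5]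
[cite: Milne1972ArithmeticAV, §1 Thm. 1 and §2 (through DokchitserDokchitserAnnals2010, §2.1, proof of Thm. 8)]
[cite: SilvermanAEC2009, Prop. VII.5.4 (a)] -/
theorem bsdp_of_classX4M_of_rankZero_twist_noMilne_of_unramifiedFact_oddPrime
    (hGZK : rank_eq_analyticRank_of_analyticRank_le_one) (hmod : hasEntireLFunction_rat)
    (hSk : Skinner2016.thmC_padicValRat_bsd_rank_zero)
    (hX : ClassX4M W p) (hr : W.analyticRank ≤ 1) (h2 : Module.finrank ℚ K = 2)
    (hdodd : Odd (NumberField.discr K)) (hdsq : Squarefree (NumberField.discr K))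
    {Cd : VariableChange ℚ} (hWd : Cd • W.quadraticTwist (NumberField.discr K : ℚ) = Wd)
    (hmult : Mult Wd p) (hram : Ram Wd p) (hr0 : Wd.analyticRank = 0)
    {C' : VariableChange K} (hW' : C' • W.baseChange K = W')
    (hA : ∀ (v : HeightOneSpectrum (𝓞 ℚ)) (w : HeightOneSpectrum (𝓞 K)),
      kodairaSymbolAt_baseChange_of_ramificationIdx_eq_one K v w W)
    (hS : ∀ v : HeightOneSpectrum (𝓞 ℚ), W.HasGoodReductionAt v ∨ W.HasMultiplicativeReductionAt v ∨
      (((primesEquiv v : ℕ) : ℤ) ∣ NumberField.discr K ∧ Wd.HasMultiplicativeReductionAt v) ∨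
      (W.HasAdditiveReductionAt v ∧ ¬ ((primesEquiv v : ℕ) : ℤ) ∣ NumberField.discr K ∧
        (p = 3 → (primesEquiv v : ℕ) ≠ 3)))
    (hK : MissingPPartOverAt W' p) : BSDp W p := by
  have hD : (NumberField.discr K : ℚ) ≠ 0 := by exact_mod_cast NumberField.discr_ne_zero K
  obtain ⟨hp2, -, hirrd⟩ := mult_irr_twist_of_classX4M hX hD ⟨Cd, hWd⟩ hmult
  have hd : BSDp Wd p := bsdp_twist_of_rankZero_ram p Wd hSk hGZK hmod hp2 hmult hirrd hram hr0
  exact bsdp_of_pPartOver_of_bsdp_twist_quadratic_of_unramifiedFact_oddPrime W p K Wd W' hGZK hmod h2 hdodd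
    hdsq hWd hW' (by omega) hA hp2 hS hK hd

/-- **X3♯(M)⁰ WITHOUT MILNE, additive places prime to `d_K` allowed, every odd `p` (`p = 3`
included), CONDITIONAL on A233: `BSD(E,p) ⇐ MissingPPartOverAt(E_K,p) ∧ MissingLowerBoundAt(E^{(D)},p)`.**
For `(E,p) ∈ X3♯(M)` (odd additive Eisenstein `p`, `ord_p j < 0`) of analytic rank `≤ 1`, a
quadratic field `K` (either signature) with `d_K` odd squarefree whose twist `Wd = C_d • W^{(d_K)}`
is MULTIPLICATIVE at `p` and of analytic rank `0`, `W` good ∨ multiplicative ∨ (`ℓ ∣ d_K` ∧ `Wd`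
multiplicative) ∨ (additive ∧ `ℓ ∤ d_K` ∧ (`p = 3 → ℓ ≠ 3`)) at every place, `W' = C' • W_K`
globally minimal, and A233 at every `(v, w)` as `hA`: `BSD(E,p)` follows from `MissingPPartOverAt W' p`
AND the LOWER half `MissingLowerBoundAt Wd p` of the X2 input of the twist (an X2 pair,
`classX2_twist_of_classX3M`; upper half = Wuthrich 2014 Prop. 21, `hW`), with `hGZK`, `hmod`, `hA`
— NOT Milne's A65. Twin of H-3's `…classX3M…_of_unramifiedFact` without the `ℓ = 2` clause.
[cite: Wuthrich2014, Prop. 21]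
[cite: Milne1972ArithmeticAV, §1 Thm. 1 and §2 (through DokchitserDokchitserAnnals2010, §2.1, proof of Thm. 8)]
[cite: SilvermanAEC2009, Prop. VII.5.4 (a)] -/
theorem bsdp_of_classX3M_of_rankZero_twist_noMilne_of_unramifiedFact_oddPrime
    (hGZK : rank_eq_analyticRank_of_analyticRank_le_one) (hmod : hasEntireLFunction_rat)
    (hW : sha_dvd_analyticSha)
    (hX : ClassX3M W p) (hr : W.analyticRank ≤ 1) (h2 : Module.finrank ℚ K = 2)
    (hdodd : Odd (NumberField.discr K)) (hdsq : Squarefree (NumberField.discr K))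
    {Cd : VariableChange ℚ} (hWd : Cd • W.quadraticTwist (NumberField.discr K : ℚ) = Wd)
    (hmult : Mult Wd p) (hr0 : Wd.analyticRank = 0)
    {C' : VariableChange K} (hW' : C' • W.baseChange K = W')
    (hA : ∀ (v : HeightOneSpectrum (𝓞 ℚ)) (w : HeightOneSpectrum (𝓞 K)),
      kodairaSymbolAt_baseChange_of_ramificationIdx_eq_one K v w W)
    (hS : ∀ v : HeightOneSpectrum (𝓞 ℚ), W.HasGoodReductionAt v ∨ W.HasMultiplicativeReductionAt v ∨
      (((primesEquiv v : ℕ) : ℤ) ∣ NumberField.discr K ∧ Wd.HasMultiplicativeReductionAt v) ∨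
      (W.HasAdditiveReductionAt v ∧ ¬ ((primesEquiv v : ℕ) : ℤ) ∣ NumberField.discr K ∧
        (p = 3 → (primesEquiv v : ℕ) ≠ 3)))
    (hK : MissingPPartOverAt W' p) (hlow : MissingLowerBoundAt Wd p) : BSDp W p := by
  have hD : (NumberField.discr K : ℚ) ≠ 0 := by exact_mod_cast NumberField.discr_ne_zero K
  have hX2d : ClassX2 Wd p := classX2_twist_of_classX3M hX hD ⟨Cd, hWd⟩ hmult
  have hd : BSDp Wd p := X2.bsdp_of_missingInputAt hW hGZK hmod Wd p (by rw [hr0]; exact zero_le_one)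
    hX2d ⟨fun _ => hlow, fun h1 => absurd (hr0.symm.trans h1) (by decide)⟩
  exact bsdp_of_pPartOver_of_bsdp_twist_quadratic_of_unramifiedFact_oddPrime W p K Wd W' hGZK hmod h2 hdodd
    hdsq hWd hW' (by omega) hA hX.p_ne_two hS hK hd

end NoMilneUnramifiedFactOddPrime

end Summit.BirchSwinnertonDyer.Rank1Residual.AdditivePotMult

end
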